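import Literature.Analysis.FluidPDE.OseenSlice
import Literature.Analysis.FluidPDE.NSBoundedMildOseenDuhamel
import Literature.Analysis.UnboundedOperators.HeatKernelBoundedData
import HarnessLib

/-!
# Passing to pointwise bounded limits in the Oseen integral equation

Analysis/FluidPDE support file (everything proved; no definitions, no named facts) for the
compactness arguments of Koch–Nadirashvili–Seregin–Šverák, *Liouville theorems for the
Navier–Stokes equations and applications*, Acta Math. 203 (2009) = arXiv:0709.3599 — Lemma 4.1,
p. 8 ("a subsequence of the sequence `u⁽ᵏ⁾` converges locally uniformly in `ℝⁿ × (0, T)` to a mild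
solution … This is a routine consequence of (smoothnessest), and the decay estimate (decay) for
the kernel") and Lemma 6.1, p. 11 (limits of uniformly bounded mild solutions on `(T_l, 0)`,
`T_l ↘ −∞`, are ancient mild solutions), as used in the proof of Theorem 6.2, p. 13
(`KNSS2009_typeI_rate_compactness` / `KNSS2009_typeI_rate_mildCompactness` of `KNSSTypeIRateCore`,
`KNSSTypeIRateMild`). In the tree's rendering of KNSS's mild solutions by the Oseen integral
equation `u(t) = e^{(t−s)Δ}u(s) − B¹_s(u, u)(t)` (`UnboundedOperators.heatExtension`,
`oseenDuhamel`), the part of these lemmas that concerns the *equation* (as opposed to the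
extraction of the subsequence, which is Arzelà–Ascoli on the §4 bounds) is dominated
convergence in the two terms, which this file proves once and for all, in any finite-dimensional
`E`:

* `tendsto_heatExtension_of_tendsto` — `e^{σΔ}a_k(x) → e^{σΔ}a(x)` for `a_k → a` pointwise with a
  uniform bound (dominated convergence under `M G_σ`);
* `tendsto_oseenKernel_slots`, `tendsto_integral_oseenKernel_of_tendsto` — continuity of the
  kernel in its tensor slots and convergence of the slices `∫ K(σ, x − y)[a_k, b_k] dy` (dominated
  convergence under the parabolic envelope of Koch–Tataru's bound (14), `OseenSlice.lean`);
* `aestronglyMeasurable_integral_oseenKernel_duhamel`, `tendsto_oseenDuhamel_of_tendsto` —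
  convergence of the Duhamel terms `B¹_s(V_k, V_k)(t)(x)` for fields a.e.-strongly measurable on
  `(s, t) × E` with continuous slices, uniformly bounded on `(s, t]`, converging pointwise
  (dominated convergence in time under `C₀ M² (t − τ)^{-1/2}`, `exists_norm_oseenSlice_le`);
* `oseen_of_tendsto` — hence the Oseen integral equation passes from the `V_k` to their
  pointwise bounded limit.

## References

* G. Koch, N. Nadirashvili, G. Seregin, V. Šverák, Acta Math. 203 (2009) 83–105 =
  arXiv:0709.3599: Lemma 4.1, p. 8; Lemma 6.1, p. 11; proof of Theorem 6.2, p. 13.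
  [KochNadirashviliSereginSverak2009]
* H. Koch, D. Tataru, Adv. Math. 157 (2001), §2 (8), §3 (14). [KochTataruAdvMath2001]
-/

noncomputable section

open MeasureTheory Set Function Filter Metric
open _root_.Topology
open scoped RealInnerProductSpace NNReal ENNReal

namespace Literature.Analysis.FluidPDE

/-! ### Passing to pointwise bounded limits in the Oseen integral equation -/

section Limits

variable {E : Type*} [NormedAddCommGroup E] [InnerProductSpace ℝ E] [FiniteDimensional ℝ E]
  [MeasurableSpace E] [BorelSpace E]

/-- **The caloric extension of a boundedly convergent sequence converges**: if `a_k → a`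
pointwise with `‖a_k‖ ≤ M` eventually (all continuous), then `e^{σΔ}a_k(x) → e^{σΔ}a(x)` for
`σ > 0` (dominated convergence under `M G_σ`). [folklore] -/
theorem tendsto_heatExtension_of_tendsto {a : ℕ → E → E} {alim : E → E} {M : ℝ}
    (hac : ∀ k, Continuous (a k)) (hbd : ∀ᶠ k in atTop, ∀ y, ‖a k y‖ ≤ M)
    (hlim : ∀ y, Tendsto (fun k => a k y) atTop (𝓝 (alim y))) {σ : ℝ} (hσ : 0 < σ) (x : E) :
    Tendsto (fun k => UnboundedOperators.heatExtension (a k) σ x) atTop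
      (𝓝 (UnboundedOperators.heatExtension alim σ x)) := by
  simp only [UnboundedOperators.heatExtension_apply]
  refine tendsto_integral_filter_of_dominated_convergence (fun y => UnboundedOperators.heatKernel σ y * M)
    (Eventually.of_forall fun k => ?_) ?_ ((UnboundedOperators.integrable_heatKernel_holds hσ).mul_const M) ?_
  · exact ((UnboundedOperators.continuous_heatKernel σ).smul
      ((hac k).comp (continuous_const.sub continuous_id))).aestronglyMeasurable
  · filter_upwards [hbd] with k hk
    refine Eventually.of_forall fun y => ?_
    rw [norm_smul, Real.norm_of_nonneg (UnboundedOperators.heatKernel_pos hσ y).le]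
    exact mul_le_mul_of_nonneg_left (hk _) (UnboundedOperators.heatKernel_pos hσ y).le
  · exact Eventually.of_forall fun y => (hlim (x - y)).const_smul _

omit [FiniteDimensional ℝ E] [MeasurableSpace E] [BorelSpace E] in
/-- The Oseen kernel is jointly continuous in its two tensor slots (it is the continuous bilinear
map `oseenKernelCLM τ z`; Koch–Tataru 2001, (8)): `K(τ, z)[a_i, b_i] → K(τ, z)[a₀, b₀]` when
`a_i → a₀`, `b_i → b₀`. [cite: KochTataruAdvMath2001, §2 (8)] -/
theorem tendsto_oseenKernel_slots (τ : ℝ) (z : E) {α : Type*} {l : Filter α} {a b : α → E}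
    {a₀ b₀ : E} (ha : Tendsto a l (𝓝 a₀)) (hb : Tendsto b l (𝓝 b₀)) :
    Tendsto (fun i => oseenKernel τ z (a i) (b i)) l (𝓝 (oseenKernel τ z a₀ b₀)) := by
  have h := ((oseenKernelCLM τ z).continuous₂.tendsto (a₀, b₀)).comp (ha.prodMk_nhds hb)
  simpa only [Function.comp_def, Function.uncurry_apply_pair, oseenKernelCLM_apply] using h

/-- **Slices of boundedly convergent sequences converge**: for `σ > 0`, if `a_k → a`, `b_k → b`
pointwise with `‖a_k‖, ‖b_k‖ ≤ M` eventually (all continuous), then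
`∫ K(σ, x − y)[a_k, b_k] dy → ∫ K(σ, x − y)[a, b] dy` (dominated convergence under the parabolic
envelope `C M² (σ + ‖x − y‖²)^{-(d+1)/2}`, Koch–Tataru (14)). [cite: KochTataruAdvMath2001, §3 (14)] -/
theorem tendsto_integral_oseenKernel_of_tendsto {a b : ℕ → E → E} {alim blim : E → E} {M : ℝ}
    (hac : ∀ k, Continuous (a k)) (hbc : ∀ k, Continuous (b k))
    (habd : ∀ᶠ k in atTop, ∀ y, ‖a k y‖ ≤ M) (hbbd : ∀ᶠ k in atTop, ∀ y, ‖b k y‖ ≤ M)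
    (halim : ∀ y, Tendsto (fun k => a k y) atTop (𝓝 (alim y)))
    (hblim : ∀ y, Tendsto (fun k => b k y) atTop (𝓝 (blim y))) {σ : ℝ} (hσ : 0 < σ) (x : E) :
    Tendsto (fun k => ∫ y, oseenKernel σ (x - y) (a k y) (b k y)) atTop
      (𝓝 (∫ y, oseenKernel σ (x - y) (alim y) (blim y))) := by
  obtain ⟨C, hC, hK⟩ := exists_norm_oseenKernel_le (E := E)
  set bound : E → ℝ := fun y =>
    C * M * M * (σ + ‖x - y‖ ^ 2) ^ (-(((Module.finrank ℝ E : ℝ) + 1) / 2)) with hbound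
  have hw : Integrable bound volume := by
    have := ((integrable_add_norm_sq_rpow_neg_half_succ (E := E) hσ).comp_sub_left x).const_mul
      (C * M * M)
    exact this
  have hmeas : ∀ k, AEStronglyMeasurable (fun y => oseenKernel σ (x - y) (a k y) (b k y)) volume :=
    fun k => (AEMeasurable.oseenKernel_comp aemeasurable_const
      (measurable_id.const_sub x).aemeasurable (hac k).aemeasurable (hbc k).aemeasurable).aestronglyMeasurable
  have hbd : ∀ᶠ k in atTop, ∀ᵐ y ∂(volume : Measure E),
      ‖oseenKernel σ (x - y) (a k y) (b k y)‖ ≤ bound y := by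
    filter_upwards [habd, hbbd] with k hka hkb
    exact Eventually.of_forall fun y => norm_oseenKernel_apply_le_weight hK hC.le hσ hka hkb x y
  have hl : ∀ᵐ y ∂(volume : Measure E), Tendsto (fun k => oseenKernel σ (x - y) (a k y) (b k y)) atTop
      (𝓝 (oseenKernel σ (x - y) (alim y) (blim y))) :=
    Eventually.of_forall fun y => tendsto_oseenKernel_slots σ (x - y) (halim y) (hblim y)
  exact tendsto_integral_filter_of_dominated_convergence bound (Eventually.of_forall hmeas) hbd hw hl

/-- Measurability in time of the Duhamel integrand `τ ↦ ∫ K(ν(t−τ), x−y)[u(τ,y), v(τ,y)] dy` on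
`(s, t)` for fields a.e.-strongly measurable on `(s, t) × E` (Fubini measurability). [folklore] -/
theorem aestronglyMeasurable_integral_oseenKernel_duhamel {u v : ℝ → E → E} {s t : ℝ} (ν : ℝ)
    (hu : AEStronglyMeasurable (uncurry u) ((volume : Measure (ℝ × E)).restrict (Ioo s t ×ˢ univ)))
    (hv : AEStronglyMeasurable (uncurry v) ((volume : Measure (ℝ × E)).restrict (Ioo s t ×ˢ univ)))
    (x : E) :
    AEStronglyMeasurable (fun τ => ∫ y, oseenKernel (ν * (t - τ)) (x - y) (u τ y) (v τ y))
      ((volume : Measure ℝ).restrict (Ioo s t)) := by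
  have h := aestronglyMeasurable_oseenKernel_duhamel' ν hu hv le_rfl x
  rw [volume_restrict_prod_univ_eq_prod] at h
  exact h.integral_prod_right'

/-- **The Duhamel term of a boundedly convergent sequence converges.** Let `s < t`, let the
fields `V_k` be a.e.-strongly measurable on `(s, t) × E` with continuous slices on `(s, t]`,
`‖V_k(τ, y)‖ ≤ M` on `(s, t] × E` eventually, and `V_k(τ, y) → W(τ, y)` for `τ ∈ (s, t]`. Then
`B¹_s(V_k, V_k)(t)(x) → B¹_s(W, W)(t)(x)`: dominated convergence in `τ` under
`C₀ M² (t − τ)^{-1/2}` (`exists_norm_oseenSlice_le`), the slices converging by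
`tendsto_integral_oseenKernel_of_tendsto` (KNSS 2009, Lemma 4.1: "a routine consequence of
(smoothnessest) and the decay estimate (decay) for the kernel"). [cite: KochNadirashviliSereginSverak2009, Lemma 4.1 (arXiv p. 8)] -/
theorem tendsto_oseenDuhamel_of_tendsto {V : ℕ → ℝ → E → E} {W : ℝ → E → E} {s t M : ℝ}
    (hst : s < t)
    (hVm : ∀ k, AEStronglyMeasurable (uncurry (V k)) ((volume : Measure (ℝ × E)).restrict (Ioo s t ×ˢ univ)))
    (hVc : ∀ k, ∀ τ ∈ Ioc s t, Continuous (V k τ))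
    (hbd : ∀ᶠ k in atTop, ∀ τ ∈ Ioc s t, ∀ y, ‖V k τ y‖ ≤ M)
    (hlim : ∀ τ ∈ Ioc s t, ∀ y, Tendsto (fun k => V k τ y) atTop (𝓝 (W τ y))) (x : E) :
    Tendsto (fun k => oseenDuhamel 1 s (V k) (V k) t x) atTop (𝓝 (oseenDuhamel 1 s W W t x)) := by
  obtain ⟨C₀, hC₀, hS⟩ := exists_norm_oseenSlice_le (E := E)
  have hM : 0 ≤ M := by
    obtain ⟨k, hk⟩ := hbd.exists
    exact (norm_nonneg _).trans (hk t ⟨hst, le_rfl⟩ x)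
  simp only [oseenDuhamel_apply]
  -- dominated convergence in `τ ∈ (s, t)`
  refine tendsto_integral_filter_of_dominated_convergence
    (fun τ => C₀ * (1 * (t - τ)) ^ (-(1 / 2 : ℝ)) * M * M)
    (Eventually.of_forall fun k => aestronglyMeasurable_integral_oseenKernel_duhamel 1 (hVm k) (hVm k) x)
    ?_ ?_ ?_
  · filter_upwards [hbd] with k hk
    refine (ae_restrict_mem measurableSet_Ioo).mono fun τ hτ => ?_
    have hσ : 0 < 1 * (t - τ) := by rw [one_mul]; exact sub_pos.2 hτ.2
    exact hS hσ (hk τ ⟨hτ.1, hτ.2.le⟩) (hk τ ⟨hτ.1, hτ.2.le⟩) x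
  · -- the majorant `C₀ (t - τ)^{-1/2} M²` is integrable on `(s, t)`
    have h := (intervalIntegral.intervalIntegrable_rpow' (a := 0) (b := t - s)
      (by norm_num : (-1 : ℝ) < -(1 / 2))).1
    have h' : IntegrableOn (fun τ => (t - τ) ^ (-(1 / 2 : ℝ))) (Ioo s t) := by
      have hmp : MeasurePreserving (fun τ : ℝ => t - τ) volume volume :=
        Measure.measurePreserving_sub_left volume t
      have := (hmp.integrableOn_comp_preimage (MeasurableEquiv.subLeft t).measurableEmbedding
        (f := fun σ : ℝ => σ ^ (-(1 / 2 : ℝ))) (s := Ioc 0 (t - s))).2 h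
      rw [preimage_const_sub_Ioc, sub_zero, sub_sub_cancel] at this
      exact this.mono_set Ioo_subset_Ico_self
    refine IntegrableOn.congr_fun (((h'.const_mul C₀).mul_const M).mul_const M) (fun τ _ => ?_)
      measurableSet_Ioo
    rw [one_mul]
  · refine (ae_restrict_mem measurableSet_Ioo).mono fun τ hτ => ?_
    have hσ : 0 < 1 * (t - τ) := by rw [one_mul]; exact sub_pos.2 hτ.2
    have hτ' : τ ∈ Ioc s t := ⟨hτ.1, hτ.2.le⟩
    exact tendsto_integral_oseenKernel_of_tendsto (fun k => hVc k τ hτ') (fun k => hVc k τ hτ')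
      (hbd.mono fun k hk => hk τ hτ') (hbd.mono fun k hk => hk τ hτ') (hlim τ hτ') (hlim τ hτ') hσ x

/-- **The Oseen integral equation passes to pointwise bounded limits** (the mechanism of
KNSS 2009, Lemma 4.1 / Lemma 6.1: limits of uniformly bounded mild solutions are mild). Under
the hypotheses of `tendsto_oseenDuhamel_of_tendsto` (with continuous slices on `[s, t]`), if
moreover `V_k(t) = e^{(t−s)Δ}V_k(s) − B¹_s(V_k, V_k)(t)` pointwise eventually, then
`W(t) = e^{(t−s)Δ}W(s) − B¹_s(W, W)(t)` pointwise. [cite: KochNadirashviliSereginSverak2009, Lemma 4.1 (p. 8) and Lemma 6.1 (p. 11), arXiv:0709.3599] -/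
theorem oseen_of_tendsto {V : ℕ → ℝ → E → E} {W : ℝ → E → E} {s t M : ℝ} (hst : s < t)
    (hVm : ∀ k, AEStronglyMeasurable (uncurry (V k)) ((volume : Measure (ℝ × E)).restrict (Ioo s t ×ˢ univ)))
    (hVc : ∀ k, ∀ τ ∈ Icc s t, Continuous (V k τ))
    (hbd : ∀ᶠ k in atTop, ∀ τ ∈ Icc s t, ∀ y, ‖V k τ y‖ ≤ M)
    (hlim : ∀ τ ∈ Icc s t, ∀ y, Tendsto (fun k => V k τ y) atTop (𝓝 (W τ y)))
    (hmild : ∀ᶠ k in atTop, ∀ x,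
      V k t x = UnboundedOperators.heatExtension (V k s) (t - s) x - oseenDuhamel 1 s (V k) (V k) t x)
    (x : E) :
    W t x = UnboundedOperators.heatExtension (W s) (t - s) x - oseenDuhamel 1 s W W t x := by
  have hs : s ∈ Icc s t := ⟨le_rfl, hst.le⟩
  have ht : t ∈ Icc s t := ⟨hst.le, le_rfl⟩
  have h1 : Tendsto (fun k => V k t x) atTop (𝓝 (W t x)) := hlim t ht x
  have h2 : Tendsto (fun k => UnboundedOperators.heatExtension (V k s) (t - s) x) atTop
      (𝓝 (UnboundedOperators.heatExtension (W s) (t - s) x)) :=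
    tendsto_heatExtension_of_tendsto (fun k => hVc k s hs) (hbd.mono fun k hk => hk s hs)
      (hlim s hs) (sub_pos.2 hst) x
  have h3 : Tendsto (fun k => oseenDuhamel 1 s (V k) (V k) t x) atTop (𝓝 (oseenDuhamel 1 s W W t x)) :=
    tendsto_oseenDuhamel_of_tendsto hst hVm (fun k τ hτ => hVc k τ ⟨hτ.1.le, hτ.2⟩)
      (hbd.mono fun k hk τ hτ => hk τ ⟨hτ.1.le, hτ.2⟩) (fun τ hτ => hlim τ ⟨hτ.1.le, hτ.2⟩) x
  have h4 : Tendsto (fun k => V k t x) atTop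
      (𝓝 (UnboundedOperators.heatExtension (W s) (t - s) x - oseenDuhamel 1 s W W t x)) :=
    (h2.sub h3).congr' (hmild.mono fun k hk => (hk x).symm)
  exact tendsto_nhds_unique h1 h4

end Limits

end Literature.Analysis.FluidPDE

end
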